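import Summits.BirchSwinnertonDyer.Rank1Residual.GaloisImage.PrimeChoiceSakamoto
import HarnessLib

/-!
# Sakamoto's prime choice on the DEEP Frobenius class: `loc_𝔮 cᵢ ≠ 0` for `n ≤ p` classes of
# `H¹(K, T̄)` at infinitely many `𝔮 ∈ frobeniusClassPrimes ρ′ S τ N′`, `ker ρ′ ≤ ker ρ`
# (cell `b2b-bsdres`, team n1011, seat p15 GEN 4, OWNERS row T-INJ-DEV, file F-C; the 'T-C55K-m'
# GEN 3 left available — its consumer is END-m2's injectivity input on the deep-class datum)

HONEST FRAMING (cell `b2b-bsdres`, run/shared/lean/b2b/bsd-rank1-residual/, verbatim in every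
file): the goal of the cell is to DELETE the COMBINATION-SHAPED residual classes of the
Birch–Swinnerton-Dyer formula for ALL analytic-rank `≤ 1` elliptic curves over `ℚ` — "full BSD
formula for every rank `≤ 1` curve in class `C`" assembled STRICTLY from published theorems — so
that the rank-`≤ 1` remainder becomes exactly the CONSTRUCTION-SHAPED classes, which are TYPED
(missing-input `Prop`s), NOT attempted. This is not "finishing BSD". Team n1011 (N10/N11, the
additive block `X4 ∧ p = 3`): research route; TOOL theorems about Galois cohomology classes of a
finite Galois module; no class theorem, nothing booked, no mark changed; no definition, no named
fact, no `sorry`.  The deep input — Chebotarev — is the tree's PROVED theorem (`frobenius_dense`).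

## What and why

The cell's T-C55K theorems (`PrimeChoice.infinite_setOf_mem_frobeniusClassPrimes_…`, seat p15 GEN 2)
choose Kolyvagin primes in Sakamoto's class `frobeniusClassPrimes ρ S τ N` OF THE MODULE `ρ = T̄`
carrying the classes.  Kolyvagin data on `T̄ = E[3]` whose primes form a DEEP class — the Frobenius
condition read in `Gal(K(E[3^{m}], μ_{3^{m}})/K)`, i.e. `frobeniusClassPrimes ρ′ S τ N′` for an
auxiliary `ρ′` with `ker ρ′ ≤ ker ρ` (the data of the injectivity dévissage, file F-B2, and of the
S24-DEEP port) — need the same choice ON THE DEEP CLASS.  This file is that: the key lemma, the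
selection and the Chebotarev step of files 2 and 4 of T-C55K re-run with
`G_F′ = ker ρ′ ⊓ Gal(K̄/K(μ_{N′})) ⊆ G_F` and (H.3) stated for `G_F′` (for `E`: n1011-p04's
`hH3_three_of_towerSurj`, cc-typer-1's `hH3_three_pow_of_irr`):

* `oneCocycleClass_eq_zero_of_forall_apply_mem_range_deep`, `exists_forall_apply_mul_notMem_range_deep`;
* `exists_mem_frobeniusClassPrimes_notMem_forall_localization_ne_zero_deep`;
* **`infinite_setOf_mem_frobeniusClassPrimes_forall_localization_ne_zero_deep`** (`n ≤ p` classes) and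
  **`…_localization_ne_zero_three_deep`** (Cor. 5.5: three classes, `3 ≤ p`) — the pair / three-class
  choice that n1011-p11's R1-58 base rigidity and G5 consume, on deep data.

References: R. Sakamoto, JTNB 36 (2024) Lemma 5.2, Cor. 5.5 [Sakamoto2024]; B. Mazur, K. Rubin,
Mem. AMS 799 (2004) Prop. 3.6.1, §3.5 (H.5).
-/

noncomputable section

open Function Field NumberField IsDedekindDomain Filter Topology
open Literature.NumberTheory.GaloisRepresentations Literature.NumberTheory.GaloisCohomology
open scoped NumberField Pointwise

universe u

namespace Summit.BirchSwinnertonDyer.Rank1Residual.GaloisImage.PrimeChoice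

/-! ## Cocycle algebra over any field: the key lemma and the selection on `G_F′` -/

section Selection

variable {K : Type u} [Field K] {M : Type u} [AddCommGroup M] [TopologicalSpace M]
  [DiscreteTopology M] {ρ : DiscreteGaloisModule K M}
  {M' : Type u} [AddCommGroup M'] [TopologicalSpace M'] [DiscreteTopology M']
  {ρ' : DiscreteGaloisModule K M'}

/-- **KEY LEMMA, deep class.** As `oneCocycleClass_eq_zero_of_forall_apply_mem_range`, with the
group `G_F′ = ker ρ′ ⊓ Gal(K̄/K(μ_{N′}))` of an AUXILIARY module `ρ′` with `ker ρ′ ≤ ker ρ` (for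
`T̄ = E[p]`: `ρ′ = E[p^{m}]`, `N′ = p^{m}`) and (H.3) stated for `G_F′`. [cite: MazurRubin2004, Prop. 3.6.1 proof, p. 31]
[cite: Sakamoto2024, Lemma 5.2 (p. 928)] -/
theorem oneCocycleClass_eq_zero_of_forall_apply_mem_range_deep {p : ℕ} [Fact p.Prime] {N' : ℕ}
    (hker : ∀ u : Field.absoluteGaloisGroup K, ρ' u = 1 → ρ u = 1)
    {τ : Field.absoluteGaloisGroup K} (e : cokerSubOne ρ τ ≃+ ZMod p)
    (hirr : ∀ A : AddSubgroup M,
      (∀ (s : Field.absoluteGaloisGroup K), ∀ m ∈ A, ρ s m ∈ A) → A = ⊥ ∨ A = ⊤)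
    (hH3 : ∀ f : contOneCocycles ρ.toTopRep,
      (∀ u : Field.absoluteGaloisGroup K, ρ' u = 1 → u ∈ rootsOfUnityFixer K N' → f.1 u = 0) →
        oneCocycleClass ρ.toTopRep f = 0)
    (c : contOneCocycles ρ.toTopRep)
    (hc : ∀ g : Field.absoluteGaloisGroup K, ρ' g = 1 → g ∈ rootsOfUnityFixer K N' →
      c.1 g ∈ ((ρ τ).toAddMonoidHom - AddMonoidHom.id M).range) :
    oneCocycleClass ρ.toTopRep c = 0 := by
  -- the image of `G_F` under `c`, a `ρ`-stable subgroup
  let A : AddSubgroup M :=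
    { carrier := {m | ∃ g : Field.absoluteGaloisGroup K, ρ' g = 1 ∧ g ∈ rootsOfUnityFixer K N' ∧
        c.1 g = m}
      zero_mem' := ⟨1, map_one ρ', Subgroup.one_mem _, contOneCocycles.apply_one c⟩
      add_mem' := by
        rintro _ _ ⟨g, hg, hgμ, rfl⟩ ⟨h, hh, hhμ, rfl⟩
        exact ⟨g * h, by rw [map_mul, hg, hh, mul_one], Subgroup.mul_mem _ hgμ hhμ,
          apply_mul_of_apply_eq_one c (hker g hg) h⟩
      neg_mem' := by
        rintro _ ⟨g, hg, hgμ, rfl⟩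
        have hinv : ρ' g⁻¹ = 1 := by
          have h := map_mul ρ' g⁻¹ g
          rw [inv_mul_cancel, map_one, hg, mul_one] at h
          exact h.symm
        exact ⟨g⁻¹, hinv, Subgroup.inv_mem _ hgμ,
          apply_inv_of_apply_eq_one c (hker g hg)⟩ }
  have hAstab : ∀ (s : Field.absoluteGaloisGroup K), ∀ m ∈ A, ρ s m ∈ A := by
    rintro s _ ⟨g, hg, hgμ, rfl⟩
    refine ⟨s * g * s⁻¹, ?_, conj_mem_rootsOfUnityFixer hgμ s,
      apply_conj_of_apply_eq_one c (hker g hg) s⟩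
    rw [map_mul, map_mul, hg, mul_one, ← map_mul, mul_inv_cancel, map_one]
  have hAle : A ≤ ((ρ τ).toAddMonoidHom - AddMonoidHom.id M).range := by
    rintro _ ⟨g, hg, hgμ, rfl⟩
    exact hc g hg hgμ
  have hAbot : A = ⊥ := by
    rcases hirr A hAstab with h | h
    · exact h
    · exact absurd (top_le_iff.mp (h ▸ hAle)) (range_sub_id_ne_top e)
  refine hH3 c fun u hu hμ => ?_
  have hmem : c.1 u ∈ A := ⟨u, hu, hμ, rfl⟩
  rw [hAbot] at hmem
  exact (AddSubgroup.mem_bot).mp hmem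


/-- **THE SELECTION on the deep class**: as `exists_forall_apply_mul_notMem_range`, with
`γ ∈ G_F′ = ker ρ′ ⊓ Gal(K̄/K(μ_{N′}))` (`ker ρ′ ≤ ker ρ`; (H.3) for `G_F′`). [cite: Sakamoto2024, Lemma 5.2 (p. 928)]
[cite: MazurRubin2004, Prop. 3.6.1 proof, p. 31] -/
theorem exists_forall_apply_mul_notMem_range_deep {p : ℕ} [Fact p.Prime] {N' : ℕ}
    (hker : ∀ u : Field.absoluteGaloisGroup K, ρ' u = 1 → ρ u = 1)
    {τ : Field.absoluteGaloisGroup K} (e : cokerSubOne ρ τ ≃+ ZMod p)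
    (hirr : ∀ A : AddSubgroup M,
      (∀ (s : Field.absoluteGaloisGroup K), ∀ m ∈ A, ρ s m ∈ A) → A = ⊥ ∨ A = ⊤)
    (hH3 : ∀ f : contOneCocycles ρ.toTopRep,
      (∀ u : Field.absoluteGaloisGroup K, ρ' u = 1 → u ∈ rootsOfUnityFixer K N' → f.1 u = 0) →
        oneCocycleClass ρ.toTopRep f = 0)
    {n : ℕ} (hn : n ≤ p) (c : Fin n → contOneCocycles ρ.toTopRep)
    (hc : ∀ i, oneCocycleClass ρ.toTopRep (c i) ≠ 0) :
    ∃ γ : Field.absoluteGaloisGroup K, ρ' γ = 1 ∧ γ ∈ rootsOfUnityFixer K N' ∧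
      ∀ i, (c i).1 (τ * γ) ∉ ((ρ τ).toAddMonoidHom - AddMonoidHom.id M).range := by
  classical
  -- the group `G_F = ker ρ ⊓ Gal(K̄/K(μ_N))` as a subgroup
  set GF : Subgroup (Field.absoluteGaloisGroup K) := ρ'.ker ⊓ rootsOfUnityFixer K N' with hGF_def
  have hmemGF : ∀ g : Field.absoluteGaloisGroup K, g ∈ GF ↔ ρ' g = 1 ∧ g ∈ rootsOfUnityFixer K N' :=
    fun g => by rw [hGF_def, Subgroup.mem_inf, ContinuousRep.mem_ker]; exact Iff.rfl
  set R : AddSubgroup M := ((ρ τ).toAddMonoidHom - AddMonoidHom.id M).range with hR_def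
  -- `π = e ∘ (mod (τ − 1)T̄) : T̄ → 𝔽_p`
  let π : M →+ ZMod p := e.toAddMonoidHom.comp (QuotientAddGroup.mk' R)
  have hπ : ∀ m, π m = e (QuotientAddGroup.mk m) := fun m => rfl
  have hπ0 : ∀ m, π m = 0 ↔ m ∈ R := fun m => by
    rw [hπ, e.map_eq_zero_iff, QuotientAddGroup.eq_zero_iff]
  -- the data of file 1's selection lemma
  let E : Fin n → (↥GF → ZMod p) := fun i g => π ((c i).1 g)
  let F : (Fin n → ZMod p) →ₗ[ZMod p] (↥GF → ZMod p) := Fintype.linearCombination (ZMod p) E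
  let Λ : (Fin n → ZMod p) →ₗ[ZMod p] ZMod p :=
    Fintype.linearCombination (ZMod p) fun i => π ((c i).1 τ)
  have hFapply : ∀ a (g : GF), F a g = ∑ i, a i * π ((c i).1 g) := fun a g => by
    change (Fintype.linearCombination (ZMod p) E a) g = _
    rw [Fintype.linearCombination_apply, Finset.sum_apply]
    simp only [Pi.smul_apply, smul_eq_mul, E]
  have hΛapply : ∀ a, Λ a = ∑ i, a i * π ((c i).1 τ) := fun a => by
    change Fintype.linearCombination (ZMod p) _ a = _
    rw [Fintype.linearCombination_apply]
    simp only [smul_eq_mul]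
  -- the integral combination `ψ_a = Σ ãᵢ cᵢ` realising `a`
  have hcomb : ∀ (a : Fin n → ZMod p) (g : Field.absoluteGaloisGroup K),
      π ((∑ i, (a i).val • c i : contOneCocycles ρ.toTopRep).1 g) = ∑ i, a i * π ((c i).1 g) := by
    intro a g
    let ev : contOneCocycles ρ.toTopRep →+ M :=
      { toFun := fun ψ => ψ.1 g, map_zero' := rfl, map_add' := fun _ _ => rfl }
    have h1 : (∑ i, (a i).val • c i : contOneCocycles ρ.toTopRep).1 g =
        ∑ i, (a i).val • (c i).1 g := by
      change ev (∑ i, (a i).val • c i) = ∑ i, (a i).val • ev (c i)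
      rw [map_sum]
      exact Finset.sum_congr rfl fun i _ => map_nsmul ev _ _
    rw [h1, map_sum]
    refine Finset.sum_congr rfl fun i _ => ?_
    rw [map_nsmul, nsmul_eq_mul, ZMod.natCast_zmod_val]
  -- each `F a` is a homomorphism on `G_F`
  have hFmul : ∀ a (g h : GF), F a (g * h) = F a g + F a h := by
    intro a g h
    rw [hFapply, hFapply, hFapply, ← Finset.sum_add_distrib]
    refine Finset.sum_congr rfl fun i _ => ?_
    rw [Subgroup.coe_mul, apply_mul_of_apply_eq_one (c i) (hker _ ((hmemGF g).mp g.2).1), map_add,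
      mul_add]
  -- compatibility `F a = 0 → Λ a = 0` (key lemma applied to `ψ_a`)
  have hFΛ : ∀ a, F a = 0 → Λ a = 0 := by
    intro a ha
    set ψ : contOneCocycles ρ.toTopRep := ∑ i, (a i).val • c i with hψ_def
    have hψ : oneCocycleClass ρ.toTopRep ψ = 0 := by
      refine oneCocycleClass_eq_zero_of_forall_apply_mem_range_deep hker e hirr hH3 ψ fun g hg hgμ => ?_
      rw [← hπ0, hψ_def, hcomb]
      have := congrFun ha ⟨g, (hmemGF g).mpr ⟨hg, hgμ⟩⟩
      rwa [hFapply] at this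
    obtain ⟨v, hv⟩ := (oneCocycleClass_eq_zero_iff _ ψ).mp hψ
    rw [hΛapply, ← hcomb, ← hψ_def, hπ0, hv τ]
    exact ⟨v, rfl⟩
  -- non-degeneracy `F eᵢ ≠ 0` (key lemma applied to `cᵢ`)
  have hFne : ∀ i, F (Pi.single i 1) ≠ 0 := by
    intro i h0
    refine hc i (oneCocycleClass_eq_zero_of_forall_apply_mem_range_deep hker e hirr hH3 (c i) ?_)
    intro g hg hgμ
    rw [← hπ0]
    have := congrFun h0 ⟨g, (hmemGF g).mpr ⟨hg, hgμ⟩⟩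
    change (Fintype.linearCombination (ZMod p) E (Pi.single i 1)) _ = 0 at this
    rwa [Fintype.linearCombination_apply_single, one_smul] at this
  -- file 1
  obtain ⟨g, hg⟩ := exists_forall_apply_add_ne_zero hn F hFmul Λ hFΛ hFne
  refine ⟨g, ((hmemGF g).mp g.2).1, ((hmemGF g).mp g.2).2, fun i hi => ?_⟩
  apply hg i
  have h1 : F (Pi.single i 1) g = π ((c i).1 g) := by
    change (Fintype.linearCombination (ZMod p) E (Pi.single i 1)) g = _
    rw [Fintype.linearCombination_apply_single, one_smul]
  have h2 : Λ (Pi.single i 1) = π ((c i).1 τ) := by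
    change Fintype.linearCombination (ZMod p) _ (Pi.single i 1) = _
    rw [Fintype.linearCombination_apply_single, one_smul]
  rw [h1, h2, add_comm, hπ, hπ, ← map_add, ← mk_apply_mul_eq τ _ (c i), ← hπ, hπ0]
  exact hi


end Selection

/-! ## Over a number field: the Chebotarev step and the theorems on the deep class -/

section Global

variable {K : Type} [Field K] [NumberField K] {M : Type} [AddCommGroup M] [TopologicalSpace M]
  [DiscreteTopology M] (ρ : DiscreteGaloisModule K M)
  {M' : Type} [AddCommGroup M'] [TopologicalSpace M'] [DiscreteTopology M']
  (ρ' : DiscreteGaloisModule K M')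

/-- **One prime of the DEEP class `frobeniusClassPrimes ρ′ S τ N′` outside any finite set with
`loc_𝔮 cᵢ ≠ 0` for all `i`** (classes of `H¹(K, T̄)`, `T̄` the module of `ρ`; Frobenius condition in
`Gal(K(T′, μ_{N′})/K)` for an auxiliary `ρ′` with `ker ρ′ ≤ ker ρ`): the selection in `G_F′`, the open
set `U ∋ τγ` cut out by `ρ′`, `μ_{N′}` and the cocycles, Chebotarev (`frobenius_dense`), and the local
criterion for `ρ` (`ρ σ = ρ τ` because `ρ′ σ = ρ′ τ`). [cite: Sakamoto2024, Lemma 5.2 (p. 928)]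
[cite: MazurRubin2004, Prop. 3.6.1 proof, pp. 30–31] -/
theorem exists_mem_frobeniusClassPrimes_notMem_forall_localization_ne_zero_deep [Finite M] [Finite M']
    (hker : ∀ u : absoluteGaloisGroup K, ρ' u = 1 → ρ u = 1)
    {p : ℕ} [Fact p.Prime] {N' : ℕ} (hN : N' ≠ 0)
    (S : Set (HeightOneSpectrum (𝓞 K))) (hS : S.Finite)
    {τ : absoluteGaloisGroup K} (e : cokerSubOne ρ τ ≃+ ZMod p)
    (hirr : ∀ A : AddSubgroup M,
      (∀ (s : absoluteGaloisGroup K), ∀ m ∈ A, ρ s m ∈ A) → A = ⊥ ∨ A = ⊤)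
    (hH3 : ∀ f : contOneCocycles ρ.toTopRep,
      (∀ u : absoluteGaloisGroup K, ρ' u = 1 → u ∈ rootsOfUnityFixer K N' → f.1 u = 0) →
        oneCocycleClass ρ.toTopRep f = 0)
    {n : ℕ} (hn : n ≤ p) (c : Fin n → contOneCocycles ρ.toTopRep)
    (hc : ∀ i, oneCocycleClass ρ.toTopRep (c i) ≠ 0)
    (T : Set (HeightOneSpectrum (𝓞 K))) (hT : T.Finite) :
    ∃ q ∈ frobeniusClassPrimes ρ' S τ N', q ∉ T ∧
      ∀ i, galoisCohomology.localization ρ (Sum.inr q) 1 (oneCocycleClass ρ.toTopRep (c i)) ≠ 0 := by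
  classical
  -- Step 1: the selection
  obtain ⟨γ, hγρ, hγμ, hγ⟩ := exists_forall_apply_mul_notMem_range_deep hker e hirr hH3 hn c hc
  set g₀ : absoluteGaloisGroup K := τ * γ with hg₀
  have hρ'g₀ : ρ' g₀ = ρ' τ := by rw [hg₀, map_mul, hγρ, mul_one]
  have hρg₀ : ρ g₀ = ρ τ := by rw [hg₀, map_mul, hker γ hγρ, mul_one]
  -- Step 2: the open set `U ∋ g₀`
  set U : Set (absoluteGaloisGroup K) :=
    {σ | (∀ m : M', ρ' σ m = ρ' g₀ m) ∧
      (∀ t : AlgebraicClosure K, t ^ N' = 1 → σ • t = g₀ • t) ∧ ∀ i, (c i).1 σ = (c i).1 g₀}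
    with hU_def
  haveI : NeZero N' := ⟨hN⟩
  haveI : NeZero (N' : K) := ⟨Nat.cast_ne_zero.mpr hN⟩
  have hUopen : IsOpen U := by
    have h1 : IsOpen {σ : absoluteGaloisGroup K | ∀ m : M', ρ' σ m = ρ' g₀ m} := by
      have heq : {σ : absoluteGaloisGroup K | ∀ m : M', ρ' σ m = ρ' g₀ m} =
          (fun σ => g₀⁻¹ * σ) ⁻¹' ⋂ m : M', {σ | ρ' σ m = m} := by
        ext σ
        simp only [Set.mem_setOf_eq, Set.mem_preimage, Set.mem_iInter, map_mul,
          Module.End.mul_apply]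
        refine forall_congr' fun m => ⟨fun h => ?_, fun h => ?_⟩
        · rw [h, ← Module.End.mul_apply, ← map_mul, inv_mul_cancel, map_one, Module.End.one_apply]
        · have h' := congrArg (ρ' g₀) h
          rwa [← Module.End.mul_apply, ← map_mul, mul_inv_cancel, map_one, Module.End.one_apply] at h'
      rw [heq]
      exact (isOpen_iInter_of_finite fun m => ρ'.isOpen_setOf_apply_eq m).preimage
        (continuous_const.mul continuous_id)
    have h2 : IsOpen {σ : absoluteGaloisGroup K | ∀ t : AlgebraicClosure K, t ^ N' = 1 → σ • t = g₀ • t} := by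
      have heq : {σ : absoluteGaloisGroup K | ∀ t : AlgebraicClosure K, t ^ N' = 1 → σ • t = g₀ • t} =
          (fun σ => g₀⁻¹ * σ) ⁻¹' (rootsOfUnityFixer K N' : Set (absoluteGaloisGroup K)) := by
        ext σ
        simp only [Set.mem_setOf_eq, Set.mem_preimage, SetLike.mem_coe, mem_rootsOfUnityFixer_iff,
          mul_smul, inv_smul_eq_iff]
      rw [heq]
      exact (isOpen_rootsOfUnityFixer K N').preimage (continuous_const.mul continuous_id)
    have h3 : IsOpen {σ : absoluteGaloisGroup K | ∀ i, (c i).1 σ = (c i).1 g₀} := by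
      have heq : {σ : absoluteGaloisGroup K | ∀ i, (c i).1 σ = (c i).1 g₀} =
          ⋂ i, (c i).1 ⁻¹' {(c i).1 g₀} := by
        ext σ; simp [Set.mem_iInter]
      rw [heq]
      exact isOpen_iInter_of_finite fun i => (isOpen_discrete _).preimage (c i).1.continuous
    simpa only [hU_def, Set.setOf_and] using h1.inter (h2.inter h3)
  have hg₀U : g₀ ∈ U := ⟨fun _ => rfl, fun _ _ => rfl, fun _ => rfl⟩
  -- Step 3: the finite set of bad places and a Frobenius in `U` away from it
  set B : Set (HeightOneSpectrum (𝓞 K)) :=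
    S ∪ T ∪ {v | ((N' : ℕ) : 𝓞 K) ∈ v.asIdeal} ∪ {v | ¬ GaloisRep.IsUnramifiedAt v ρ} ∪
      {v | ¬ GaloisRep.IsUnramifiedAt v ρ'} ∪
      {v | ¬ ∀ i, ∀ 𝔓 ∈ v.primesAbove, ∀ g ∈ 𝔓.inertia (absoluteGaloisGroup K), (c i).1 g = 0}
    with hB_def
  have hBfin : B.Finite := by
    refine ((((hS.union hT).union (finite_setOf_natCast_mem (K := K) (m := N'))).union ?_).union
      ?_).union ?_
    · exact eventually_cofinite.1 (eventually_isUnramifiedAt ρ)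
    · exact eventually_cofinite.1 (eventually_isUnramifiedAt ρ')
    · exact eventually_cofinite.1
        (eventually_all.2 fun i => eventually_forall_inertia_apply_eq_zero ρ (c i))
  have hdense := absoluteGaloisGroup.frobenius_dense
    Literature.NumberTheory.Automorphic.chebotarev_artinRep_of_galoisSide K B hBfin
  obtain ⟨σ, ⟨v, hvB, 𝔓, h𝔓, hσ𝔓⟩, hσU⟩ := hdense.exists_mem_open hUopen ⟨g₀, hg₀U⟩
  simp only [hB_def, Set.mem_union, Set.mem_setOf_eq, not_or, not_not] at hvB
  obtain ⟨⟨⟨⟨⟨hvS, hvT⟩, hvN⟩, hunr⟩, hunr'⟩, hcI⟩ := hvB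
  obtain ⟨hσρ, hσμ, hσc⟩ := hσU
  have hρ'σ : ρ' σ = ρ' τ := (LinearMap.ext hσρ).trans hρ'g₀
  have hρσ : ρ σ = ρ τ := by
    have h1 : ρ' (σ * τ⁻¹) = 1 := by rw [map_mul, hρ'σ, ← map_mul, mul_inv_cancel, map_one]
    have h2 := hker _ h1
    have h3 : ρ (σ * τ⁻¹) * ρ τ = 1 * ρ τ := congrArg (· * ρ τ) h2
    rwa [← map_mul, inv_mul_cancel_right, one_mul] at h3
  -- Step 4: `v ∈ 𝒫` and the localisations are non-zero
  refine ⟨v, ⟨hvS, hvN, hunr', σ, ⟨𝔓, h𝔓, hσ𝔓⟩, fun m => ?_, fun ζ hζ => ?_⟩, hvT, fun i => ?_⟩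
  · rw [map_mul, hρ'σ, ← map_mul, mul_inv_cancel, map_one, Module.End.one_apply]
  · have hζ' : (τ⁻¹ • ζ) ^ N' = 1 := by rw [← smul_pow', hζ, smul_one]
    rw [mul_smul, hσμ _ hζ', hg₀, mul_smul, (mem_rootsOfUnityFixer_iff.mp hγμ) _ hζ',
      smul_inv_smul]
  · rw [Ne, localization_oneCocycleClass_eq_zero_iff_of_isArithFrobAt ρ v hunr (c i) (hcI i) h𝔓 hσ𝔓,
      hσc i, hρσ]
    exact hγ i


/-- **Sakamoto's prime choice on the DEEP class — THEOREM**: for `n ≤ p` non-zero classes of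
`H¹(K, T̄)` there are infinitely many `𝔮 ∈ frobeniusClassPrimes ρ′ S τ N′` (Frobenius condition
through the auxiliary `ρ′`, `ker ρ′ ≤ ker ρ`) with `loc_𝔮 cᵢ ≠ 0` for all `i`. [cite: Sakamoto2024, Lemma 5.2 and Cor. 5.5 (pp. 928–930)]
[cite: MazurRubin2004, Prop. 3.6.1 (pp. 30–31)] -/
theorem infinite_setOf_mem_frobeniusClassPrimes_forall_localization_ne_zero_deep [Finite M] [Finite M']
    (hker : ∀ u : absoluteGaloisGroup K, ρ' u = 1 → ρ u = 1)
    {p : ℕ} [Fact p.Prime] {N' : ℕ} (hN : N' ≠ 0)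
    (S : Set (HeightOneSpectrum (𝓞 K))) (hS : S.Finite)
    {τ : absoluteGaloisGroup K} (hτ : Nonempty (cokerSubOne ρ τ ≃+ ZMod p))
    (hirr : ∀ A : AddSubgroup M,
      (∀ (s : absoluteGaloisGroup K), ∀ m ∈ A, ρ s m ∈ A) → A = ⊥ ∨ A = ⊤)
    (hH3 : ∀ f : contOneCocycles ρ.toTopRep,
      (∀ u : absoluteGaloisGroup K, ρ' u = 1 → u ∈ rootsOfUnityFixer K N' → f.1 u = 0) →
        oneCocycleClass ρ.toTopRep f = 0)
    {n : ℕ} (hn : n ≤ p) (c : Fin n → galoisCohomology ρ 1) (hc : ∀ i, c i ≠ 0) :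
    {q | q ∈ frobeniusClassPrimes ρ' S τ N' ∧
      ∀ i, galoisCohomology.localization ρ (Sum.inr q) 1 (c i) ≠ 0}.Infinite := by
  classical
  choose φ hφ using fun i => oneCocycleClass_surjective ρ.toTopRep (c i)
  have hφne : ∀ i, oneCocycleClass ρ.toTopRep (φ i) ≠ 0 := fun i => by rw [hφ i]; exact hc i
  intro hfin
  obtain ⟨q, hq, hqT, hloc⟩ :=
    exists_mem_frobeniusClassPrimes_notMem_forall_localization_ne_zero_deep ρ ρ' hker hN S hS hτ.some
      hirr hH3 hn φ hφne _ hfin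
  exact hqT ⟨hq, fun i => by rw [← hφ i]; exact hloc i⟩

/-- **Cor. 5.5 on the DEEP class** (three classes of `H¹(K, T̄)`, `3 ≤ p`; primes `frobeniusClassPrimes ρ′ S τ N′`): for non-zero
`c₁, c₂, c₃ ∈ H¹(K, T̄)` there are infinitely many `𝔮 ∈ frobeniusClassPrimes ρ S τ N` with
`loc_𝔮 c₁ ≠ 0 ∧ loc_𝔮 c₂ ≠ 0 ∧ loc_𝔮 c₃ ≠ 0` — LITERALLY the shape of the hypothesis `hC55` of
`CoreRankZero.kolyvaginSystems_eq_bot_of_hasCoreRank_zero_of_selfDual` /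
`CoreRankZero.kummer_kolyvaginSystems_eq_bot[_rat]` when `D.primes = frobeniusClassPrimes ρ S τ N`.
Sakamoto, JTNB 36 (2024), Cor. 5.5 (p. 929): "Let `c₁, c₂, c₃ ∈ H¹(K, T̄)` be non-zero elements.
Then there are infinitely many primes `𝔮 ∈ 𝒫` satisfying `loc_𝔮(c_i) ≠ 0` for any `1 ≤ i ≤ 3`."
[cite: Sakamoto2024, Cor. 5.5 (p. 929)] -/
theorem infinite_setOf_mem_frobeniusClassPrimes_localization_ne_zero_three_deep [Finite M] [Finite M']
    (hker : ∀ u : absoluteGaloisGroup K, ρ' u = 1 → ρ u = 1)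
    {p : ℕ} [Fact p.Prime] (hp : 3 ≤ p) {N' : ℕ} (hN : N' ≠ 0)
    (S : Set (HeightOneSpectrum (𝓞 K))) (hS : S.Finite)
    {τ : absoluteGaloisGroup K} (hτ : Nonempty (cokerSubOne ρ τ ≃+ ZMod p))
    (hirr : ∀ A : AddSubgroup M,
      (∀ (s : absoluteGaloisGroup K), ∀ m ∈ A, ρ s m ∈ A) → A = ⊥ ∨ A = ⊤)
    (hH3 : ∀ f : contOneCocycles ρ.toTopRep,
      (∀ u : absoluteGaloisGroup K, ρ' u = 1 → u ∈ rootsOfUnityFixer K N' → f.1 u = 0) →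
        oneCocycleClass ρ.toTopRep f = 0) :
    ∀ c₁ c₂ c₃ : galoisCohomology ρ 1, c₁ ≠ 0 → c₂ ≠ 0 → c₃ ≠ 0 →
      {q ∈ frobeniusClassPrimes ρ' S τ N' | galoisCohomology.localization ρ (Sum.inr q) 1 c₁ ≠ 0 ∧
        galoisCohomology.localization ρ (Sum.inr q) 1 c₂ ≠ 0 ∧
        galoisCohomology.localization ρ (Sum.inr q) 1 c₃ ≠ 0}.Infinite := by
  intro c₁ c₂ c₃ h₁ h₂ h₃
  have hc : ∀ i : Fin 3, ![c₁, c₂, c₃] i ≠ 0 := by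
    intro i
    fin_cases i
    · exact h₁
    · exact h₂
    · exact h₃
  refine (infinite_setOf_mem_frobeniusClassPrimes_forall_localization_ne_zero_deep ρ ρ' hker hN S hS hτ
    hirr hH3 hp ![c₁, c₂, c₃] hc).mono ?_
  rintro q ⟨hq, h⟩
  exact ⟨hq, h 0, h 1, h 2⟩


end Global

end Summit.BirchSwinnertonDyer.Rank1Residual.GaloisImage.PrimeChoice

end
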